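import Summits.BirchSwinnertonDyer.Rank1Residual.GaloisImage.FiniteSingularComparisonField
import Mathlib.LinearAlgebra.Matrix.Charpoly.Coeff
import Mathlib.FieldTheory.Finiteness
import Mathlib.Data.ZMod.QuotientGroup
import HarnessLib

/-!
# The canonical finite–singular comparison map is an isomorphism, VI: the prime-POWER modulus
# (`R = ℤ/p^n`): reduction modulo `p` and the Nakayama step of [MR04] Lemma 1.2.3
# (cell `b2b-bsdres`, team n1011, seat p11 gen 4, OWNERS row T-HCC-adm, sequel F2′; file 6)

HONEST FRAMING (cell `b2b-bsdres`, run/shared/lean/b2b/bsd-rank1-residual/, verbatim in every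
file): the goal of the cell is to DELETE the COMBINATION-SHAPED residual classes of the
Birch–Swinnerton-Dyer formula for ALL analytic-rank `≤ 1` elliptic curves over `ℚ` — "full BSD
formula for every rank `≤ 1` curve in class `C`" assembled STRICTLY from published theorems — so
that the rank-`≤ 1` remainder becomes exactly the CONSTRUCTION-SHAPED classes, which are TYPED
(missing-input `Prop`s), NOT attempted. This is not "finishing BSD". Team n1011 (N10 / N11, the
additive block X4 ∧ `p = 3`): research route on the CONSTRUCTION-SHAPED class X4; no claim beyond the
stated classes; nothing is booked. TOOL theorems of linear algebra; no definition, no named fact,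
no `sorry`.

## What is proved (pure linear algebra over `R = ℤ/p^n`, `p` prime, `n ≥ 1`)

Mazur–Rubin, *Kolyvagin systems*, Lemma 1.2.3, proof: "When `R` is a field this is Corollary A.2.6
of [Ru6].  Applying that case to the `R/m`-module `T/mT` and using Nakayama's Lemma we see that
`Q(Fr⁻¹)` is surjective."  For an `R`-linear endomorphism `ψ` of a free `R`-module `M` of finite
rank with `M/(ψ − 1)M ≃ ℤ/p^n` (free of rank one) and `χ_ψ(1) = 0`:

* `PrimePow.exists_aeval_divByMonic_charpoly_eq` — **`Q₁(ψ)`, `Q₁ = χ_ψ /ₘ (X − 1)`, maps ONTO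
  `ker (ψ − 1)`**.  Reduction: through a basis `b`, the matrix `G` of `ψ` reduces to `Ḡ` over `𝔽_p`
  acting on `V = 𝔽_p^ι`, with reduction map `π : M → V` (coordinates mod `p`), `π ∘ ψ = Ḡ ∘ π`,
  `ker π = pM`, `χ_Ḡ = χ_ψ mod p` (Mathlib `Matrix.charpoly_map`) and `dim ker (Ḡ − 1) = 1`
  (`#coker (Ḡ − 1) = #(M/((ψ − 1)M + pM)) = #(ℤ/p^n / p) = p`); file 1 gives
  `range Q̄₁(Ḡ) = ker (Ḡ − 1)`.  Lift ("Nakayama"): for `a ∈ D = ker (ψ − 1)`,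
  `a − Q₁(ψ) m ∈ D ∩ pM = pD` (`PrimePow.mem_smul_of_mem_ker_of_smul`, from `M[p] = p^{n−1}M` and
  `(ℤ/p^n)[p^{n−1}] = p·ℤ/p^n`), and iterating `n` times kills the error term.

References: B. Mazur, K. Rubin, Mem. AMS 799 (2004), Lemma 1.2.3 (pp. 10–11); K. Rubin, PCMI 18
(2011), Ex. 1.9.7.
-/

noncomputable section

open Polynomial Module

namespace Summit.BirchSwinnertonDyer.Rank1Residual.GaloisImage.FSComp.PrimePow

/-! ### §1 Arithmetic of `ℤ/p^n` -/

section ZModPow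

variable {p n : ℕ} [hp : Fact p.Prime]

/-- In `ℤ/p^n` (`n ≥ 1`): `p · c = 0 ⟹ c = p^{n−1} · e`. [folklore] -/
theorem exists_eq_pow_pred_mul_of_mul_eq_zero (hn : n ≠ 0) (c : ZMod (p ^ n))
    (hc : (p : ZMod (p ^ n)) * c = 0) : ∃ e : ZMod (p ^ n), c = (p : ZMod (p ^ n)) ^ (n - 1) * e := by
  haveI : NeZero (p ^ n) := ⟨pow_ne_zero _ hp.out.ne_zero⟩
  have h1 : p ^ n ∣ p * c.val := by
    rw [← ZMod.natCast_eq_zero_iff, Nat.cast_mul, ZMod.natCast_zmod_val]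
    exact hc
  have hpn : p ^ n = p * p ^ (n - 1) := by
    rw [← pow_succ', Nat.sub_add_cancel (Nat.one_le_iff_ne_zero.mpr hn)]
  have h1' : p * p ^ (n - 1) ∣ p * c.val := by
    calc p * p ^ (n - 1) = p ^ n := hpn.symm
      _ ∣ p * c.val := h1
  obtain ⟨e, he⟩ := Nat.dvd_of_mul_dvd_mul_left hp.out.pos h1'
  refine ⟨e, ?_⟩
  calc c = (c.val : ZMod (p ^ n)) := (ZMod.natCast_zmod_val c).symm
    _ = ((p ^ (n - 1) * e : ℕ) : ZMod (p ^ n)) := by rw [he]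
    _ = (p : ZMod (p ^ n)) ^ (n - 1) * e := by push_cast; ring

/-- In `ℤ/p^n` (`n ≥ 1`): `p^{n−1} · c = 0 ⟹ c = p · e`. [folklore] -/
theorem exists_eq_mul_of_pow_pred_mul_eq_zero (hn : n ≠ 0) (c : ZMod (p ^ n))
    (hc : (p : ZMod (p ^ n)) ^ (n - 1) * c = 0) : ∃ e : ZMod (p ^ n), c = (p : ZMod (p ^ n)) * e := by
  haveI : NeZero (p ^ n) := ⟨pow_ne_zero _ hp.out.ne_zero⟩
  have h1 : p ^ n ∣ p ^ (n - 1) * c.val := by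
    rw [← ZMod.natCast_eq_zero_iff, Nat.cast_mul, Nat.cast_pow, ZMod.natCast_zmod_val]
    exact hc
  have hpn : p ^ n = p ^ (n - 1) * p := by
    rw [← pow_succ, Nat.sub_add_cancel (Nat.one_le_iff_ne_zero.mpr hn)]
  have h1' : p ^ (n - 1) * p ∣ p ^ (n - 1) * c.val := by
    calc p ^ (n - 1) * p = p ^ n := hpn.symm
      _ ∣ p ^ (n - 1) * c.val := h1
  obtain ⟨e, he⟩ := Nat.dvd_of_mul_dvd_mul_left (pow_pos hp.out.pos _) h1'
  refine ⟨e, ?_⟩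
  calc c = (c.val : ZMod (p ^ n)) := (ZMod.natCast_zmod_val c).symm
    _ = ((p * e : ℕ) : ZMod (p ^ n)) := by rw [he]
    _ = (p : ZMod (p ^ n)) * e := by push_cast; ring

/-- The multiples of `p` in `ℤ/p^n` (`n ≥ 1`) number `p^{n−1}`. [folklore] -/
theorem natCard_zmultiples_natCast (hn : n ≠ 0) :
    Nat.card (AddSubgroup.zmultiples (p : ZMod (p ^ n))) = p ^ (n - 1) := by
  have hpn0 : p ^ n ≠ 0 := pow_ne_zero _ hp.out.ne_zero
  rw [Nat.card_zmultiples, ZMod.addOrderOf_coe p hpn0,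
    Nat.gcd_eq_right (dvd_pow_self p hn)]
  conv_lhs => rw [← Nat.sub_add_cancel (Nat.one_le_iff_ne_zero.mpr hn), pow_succ]
  exact Nat.mul_div_cancel _ hp.out.pos

end ZModPow

/-! ### §2 Reduction modulo `p` of a free `ℤ/p^n`-module with an endomorphism -/

section Reduction

variable {p n : ℕ} [hp : Fact p.Prime] [NeZero n]
variable {M : Type*} [AddCommGroup M] [Module (ZMod (p ^ n)) M] [Module.Free (ZMod (p ^ n)) M]
  [Module.Finite (ZMod (p ^ n)) M]

/-- `p`-torsion of a free `ℤ/p^n`-module: **`p · m = 0 ⟹ m ∈ p^{n−1} M`** (coordinatewise).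
[folklore] -/
theorem exists_eq_pow_pred_smul_of_smul_eq_zero (m : M) (hm : (p : ZMod (p ^ n)) • m = 0) :
    ∃ m' : M, m = (p : ZMod (p ^ n)) ^ (n - 1) • m' := by
  classical
  let b := Module.Free.chooseBasis (ZMod (p ^ n)) M
  have hcoord : ∀ i, (p : ZMod (p ^ n)) * b.repr m i = 0 := fun i => by
    have h := congrArg (fun x => b.repr x i) hm
    simp only [map_smul, map_zero, Finsupp.smul_apply, smul_eq_mul, Finsupp.coe_zero,
      Pi.zero_apply] at h
    exact h
  choose e he using fun i => exists_eq_pow_pred_mul_of_mul_eq_zero (NeZero.ne n) (b.repr m i)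
    (hcoord i)
  refine ⟨∑ i, e i • b i, ?_⟩
  rw [Finset.smul_sum]
  conv_lhs => rw [← b.sum_repr m]
  refine Finset.sum_congr rfl fun i _ => ?_
  rw [he i, smul_smul]

variable (ψ : Module.End (ZMod (p ^ n)) M)

/-- **`D ∩ pM = pD` for `D = ker (ψ − 1)` when `M/(ψ − 1)M ≃ ℤ/p^n`** (the direct-summand property
used in the Nakayama step): if `ψ d = d` and `d = p · x` then `d = p · d′` with `ψ d′ = d′`.
(`(ψ−1)x ∈ M[p] = p^{n−1}M`, `= p^{n−1}w`; in `M/(ψ−1)M ≅ ℤ/p^n` the class of `w` is killed by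
`p^{n−1}`, hence `w ≡ p·w′`, so `(ψ−1)x = (ψ−1)(p^{n−1}s)` and `d′ = x − p^{n−1}s` works.) [folklore] -/
theorem mem_smul_of_mem_ker_of_smul
    (hcok : Nonempty ((M ⧸ (LinearMap.range (ψ - 1)).toAddSubgroup) ≃+ ZMod (p ^ n)))
    {d x : M} (hd : ψ d = d) (hx : d = (p : ZMod (p ^ n)) • x) :
    ∃ d' : M, ψ d' = d' ∧ d = (p : ZMod (p ^ n)) • d' := by
  obtain ⟨e⟩ := hcok
  set R₁ := (LinearMap.range (ψ - 1)).toAddSubgroup with hR₁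
  have hmemR₁ : ∀ y, y ∈ R₁ ↔ ∃ z, ψ z - z = y := fun y => by
    rw [hR₁, Submodule.mem_toAddSubgroup, LinearMap.mem_range]
    simp only [LinearMap.sub_apply, Module.End.one_apply]
  -- `y := (ψ - 1) x` is `p`-torsion
  have hy : (p : ZMod (p ^ n)) • (ψ x - x) = 0 := by
    rw [smul_sub, ← map_smul, ← hx, hd, sub_self]
  obtain ⟨w, hw⟩ := exists_eq_pow_pred_smul_of_smul_eq_zero (ψ x - x) hy
  have hnat : ∀ (k : ℕ) (m : M), (k : ZMod (p ^ n)) • m = k • m := fun k m =>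
    Nat.cast_smul_eq_nsmul _ k m
  -- the class of `w` is killed by `p^{n-1}`
  have hcl : (p ^ (n - 1) : ℕ) • (QuotientAddGroup.mk w : M ⧸ R₁) = 0 := by
    rw [← QuotientAddGroup.mk_nsmul, QuotientAddGroup.eq_zero_iff, hmemR₁]
    refine ⟨x, ?_⟩
    rw [hw, ← hnat, Nat.cast_pow]
  -- transport to `ℤ/p^n`: `e [w] = p * y'`
  have hcl' : (p : ZMod (p ^ n)) ^ (n - 1) * e (QuotientAddGroup.mk w) = 0 := by
    have h := congrArg e hcl
    rw [map_nsmul, map_zero, nsmul_eq_mul, Nat.cast_pow] at h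
    exact h
  obtain ⟨y', hy'⟩ := exists_eq_mul_of_pow_pred_mul_eq_zero (NeZero.ne n) _ hcl'
  obtain ⟨w'bar, hw'bar⟩ := e.surjective y'
  obtain ⟨w', rfl⟩ := QuotientAddGroup.mk_surjective w'bar
  -- `w - p • w' ∈ R₁`
  have hdiff : w - (p : ZMod (p ^ n)) • w' ∈ R₁ := by
    rw [hnat, ← QuotientAddGroup.eq_zero_iff, QuotientAddGroup.mk_sub, QuotientAddGroup.mk_nsmul]
    apply e.injective
    rw [map_sub, map_zero, map_nsmul, hy', hw'bar, nsmul_eq_mul, sub_self]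
  obtain ⟨s, hs⟩ := (hmemR₁ _).mp hdiff
  -- `d' := x - p^{n-1} • s`
  refine ⟨x - (p : ZMod (p ^ n)) ^ (n - 1) • s, ?_, ?_⟩
  · -- `(ψ - 1)(x - p^{n-1} s) = p^{n-1} w - p^{n-1}(w - p w') = p^n w' = 0`
    have hpn : (p : ZMod (p ^ n)) ^ (n - 1) * (p : ZMod (p ^ n)) = 0 := by
      rw [← pow_succ, Nat.sub_add_cancel (Nat.one_le_iff_ne_zero.mpr (NeZero.ne n)),
        ← Nat.cast_pow, ZMod.natCast_self]
    have key : ψ (x - (p : ZMod (p ^ n)) ^ (n - 1) • s) - (x - (p : ZMod (p ^ n)) ^ (n - 1) • s) = 0 := by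
      rw [map_sub, map_smul]
      calc ψ x - (p : ZMod (p ^ n)) ^ (n - 1) • ψ s - (x - (p : ZMod (p ^ n)) ^ (n - 1) • s)
          = (ψ x - x) - (p : ZMod (p ^ n)) ^ (n - 1) • (ψ s - s) := by rw [smul_sub]; abel
        _ = 0 := by rw [hw, hs, smul_sub, smul_smul, hpn, zero_smul, sub_zero, sub_self]
    exact sub_eq_zero.mp key
  · rw [smul_sub, ← hx, smul_smul, mul_comm, ← pow_succ,
      Nat.sub_add_cancel (Nat.one_le_iff_ne_zero.mpr (NeZero.ne n)), ← Nat.cast_pow,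
      ZMod.natCast_self, zero_smul, sub_zero]

end Reduction

end Summit.BirchSwinnertonDyer.Rank1Residual.GaloisImage.FSComp.PrimePow

end
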